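import Literature.AlgebraicTopology.SingularHomology.HurewiczOne
import Literature.AlgebraicTopology.SingularHomology.ChainSubcomplex
import Mathlib.AlgebraicTopology.FundamentalGroupoid.SimplyConnected
import HarnessLib

/-!
# `H₁(X; M) = 0` for a simply connected space (Hatcher Thm. 2A.1, the case `π₁ = 1`)

A. Hatcher, *Algebraic Topology*, CUP 2002, §2.A, Thm. 2A.1: for path-connected `X` the Hurewicz
map `h : π₁(X, x₀) → H₁(X)` is onto with kernel the commutator subgroup; in particular
**`H₁(X; ℤ) = 0` when `X` is simply connected**. The tree has the statement of Thm. 2A.1 as the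
named fact `Literature.AlgebraicTopology.SingularHomology.singularHomology.hurewicz_one` (`Hurewicz.lean`) and the Hurewicz *homomorphism*
with its chain-level calculus (`HurewiczOne.lean`: `d_single_ofPath`, `d_single_ofTrans`,
`d_homotopyChain`, `d_single_const₂`). This file PROVES the simply connected case, for Mathlib's
singular homology `Literature.singularHomology R M X 1` and **every coefficient module `M`**, by the
chain-level half of Hatcher's argument:

* `Literature.AlgebraicTopology.SingularHomology.SingularSimplex.toPath`, `ofPath_toPath`, `exists_eq_ofPath`: every singular `1`-simplex is
  the `1`-simplex of a path.
* `Literature.AlgebraicTopology.SingularHomology.single_ofPath_mem_of_homotopic_refl`, `single_ofPath_loop_mem`: a null-homotopic loop — in a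
  simply connected space, every loop — is a boundary.
* `Literature.AlgebraicTopology.SingularHomology.single_ofPath_trans_sub_mem`: `γ · γ' ≡ γ + γ' (mod ∂C₂)`.
* `Literature.AlgebraicTopology.SingularHomology.single_ofPath_sub_mem`: with chosen paths `ω_p` from a base point, `γ ≡ ω_b - ω_a (mod ∂C₂)`
  for every path `γ : a ⇝ b` (the loops `ω_a · γ · ω_b⁻¹` and `ω_b · ω_b⁻¹` are boundaries).
* `Literature.AlgebraicTopology.SingularHomology.isZero_singularHomology_one_of_simplyConnectedSpace` (**main**): `H₁(X; M) = 0`. The linear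
  map `Φ : C₀ → C₁`, `[p] ↦ ω_p` (defined on Mathlib's chains through the comparison
  `csingularChainComplex.compInv` with concrete chains), satisfies `σ ≡ Φ(∂σ)` for every singular
  `1`-simplex, hence (`singularChainComplex.hom_ext`) `z ≡ Φ(∂z) = 0 (mod ∂C₂)` for every `1`-cycle.

This discharges the hypothesis `hH : hurewicz_one` of the homotopy-4-sphere criterion
(`HomotopyS4Criterion.lean`, `spc4.S10`). Everything is proved; nothing is asserted.

## References

* A. Hatcher, *Algebraic Topology*, CUP 2002, §2.A, Thm. 2A.1 and its proof (pp. 166–167)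
  [HatcherAT2002].
-/

noncomputable section

open CategoryTheory Limits

universe u v

namespace Literature.AlgebraicTopology.SingularHomology

variable (R : Type v) [CommRing R] (M : Type v) [AddCommGroup M] [Module R M]
variable {X : Type u} [TopologicalSpace X]

open SingularSimplex singularChainComplex StdSimplex

namespace SingularSimplex

/-- The path `t ↦ σ(1 - t, t)` of a singular `1`-simplex `σ`, from `σ(v₀)` to `σ(v₁)`. [folklore] -/
def toPath (σ : SingularSimplex X 1) :
    Path (toContinuousMap σ (ofUnitInterval 0)) (toContinuousMap σ (ofUnitInterval 1)) where
  toFun t := toContinuousMap σ (ofUnitInterval t)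
  continuous_toFun := (toContinuousMap σ).continuous.comp continuous_ofUnitInterval
  source' := rfl
  target' := rfl

/-- Every singular `1`-simplex is the `1`-simplex of its path: `ofPath σ.toPath = σ`. [folklore] -/
lemma ofPath_toPath (σ : SingularSimplex X 1) : ofPath σ.toPath = σ := by
  apply toContinuousMap.injective
  ext s
  rw [ofPath_apply]
  change toContinuousMap σ (ofUnitInterval (toUnitInterval s)) = _
  rw [ofUnitInterval_toUnitInterval]

/-- Every singular `1`-simplex is `ofPath γ` for a path `γ`. [folklore] -/
lemma exists_eq_ofPath (σ : SingularSimplex X 1) : ∃ (a b : X) (γ : Path a b), σ = ofPath γ :=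
  ⟨_, _, σ.toPath, (ofPath_toPath σ).symm⟩

end SingularSimplex

/-! ### Degree-one chains modulo boundaries -/

section Boundaries

variable (X) in
/-- The `1`-boundaries `∂ C₂(X; M) ⊆ C₁(X; M)`. [folklore] -/
abbrev boundariesOne : Submodule R ((singularChainComplex R M X).X 1) :=
  LinearMap.range ((singularChainComplex R M X).d 2 1).hom

variable {R M}

/-- `∂ w` is a boundary. [folklore] -/
lemma d_mem_boundariesOne (w : (singularChainComplex R M X).X 2) :
    (singularChainComplex R M X).d 2 1 w ∈ boundariesOne R M X := ⟨w, rfl⟩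

variable (m : M)

/-- A null-homotopic loop is a boundary: `m γ ∈ ∂C₂` if `γ ≃ refl` (Hatcher 2002, proof of
Thm. 2A.1: the homotopy chain and the constant `2`-simplex). [folklore] -/
lemma single_ofPath_mem_of_homotopic_refl {x : X} {γ : Path x x} (h : γ.Homotopic (Path.refl x)) :
    single (R := R) (ofPath γ) m ∈ boundariesOne R M X := by
  obtain ⟨F⟩ := h
  have h₁ := d_mem_boundariesOne (homotopyChain R M m F)
  rw [d_homotopyChain] at h₁
  have h₂ := d_mem_boundariesOne (X := X) (single (R := R) (const₂ x) m)
  rw [d_single_const₂] at h₂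
  simpa using (boundariesOne R M X).add_mem h₁ h₂

/-- In a simply connected space every loop is a boundary. [folklore] -/
lemma single_ofPath_loop_mem [SimplyConnectedSpace X] {x : X} (γ : Path x x) :
    single (R := R) (ofPath γ) m ∈ boundariesOne R M X :=
  single_ofPath_mem_of_homotopic_refl m (SimplyConnectedSpace.paths_homotopic γ (Path.refl x))

/-- Additivity modulo boundaries: `m (γ · γ') - m γ - m γ' ∈ ∂C₂` (Hatcher 2002, proof of
Thm. 2A.1). [folklore] -/
lemma single_ofPath_trans_sub_mem {x y z : X} (γ : Path x y) (γ' : Path y z) :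
    single (R := R) (ofPath (γ.trans γ')) m - single (R := R) (ofPath γ) m -
        single (R := R) (ofPath γ') m ∈ boundariesOne R M X := by
  have h := d_mem_boundariesOne (X := X) (single (R := R) (ofTrans γ γ') m)
  rw [d_single_ofTrans] at h
  have h' := (boundariesOne R M X).neg_mem h
  convert h' using 1
  abel

/-- **The key homology**: in a simply connected space with base point `x₀` and chosen paths
`ω_p : x₀ ⇝ p`, every path `γ : a ⇝ b` satisfies `m γ ≡ m ω_b - m ω_a (mod ∂C₂)`: the loop
`ω_a · γ · ω_b⁻¹` and the loop `ω_b · ω_b⁻¹` are boundaries, and `∂` of the `2`-simplices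
`ofTrans` identifies concatenation with sum (Hatcher 2002, proof of Thm. 2A.1). [cite: HatcherAT2002, Thm. 2A.1] -/
lemma single_ofPath_sub_mem [SimplyConnectedSpace X] {x₀ : X} (ω : ∀ p : X, Path x₀ p) {a b : X}
    (γ : Path a b) :
    single (R := R) (ofPath γ) m -
        (single (R := R) (ofPath (ω b)) m - single (R := R) (ofPath (ω a)) m) ∈
      boundariesOne R M X := by
  set B := boundariesOne R M X
  have h1 := single_ofPath_trans_sub_mem (R := R) m (ω a) γ
  have h2 := single_ofPath_trans_sub_mem (R := R) m ((ω a).trans γ) (ω b).symm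
  have h3 : single (R := R) (ofPath (((ω a).trans γ).trans (ω b).symm)) m ∈ B :=
    single_ofPath_loop_mem m _
  have h4 := single_ofPath_trans_sub_mem (R := R) m (ω b) (ω b).symm
  have h5 : single (R := R) (ofPath ((ω b).trans (ω b).symm)) m ∈ B := single_ofPath_loop_mem m _
  -- the goal is the linear combination `-h2 + h3 - h1 + h4 - h5` of the five boundaries
  have key : single (R := R) (ofPath γ) m -
      (single (R := R) (ofPath (ω b)) m - single (R := R) (ofPath (ω a)) m) =
      -(single (R := R) (ofPath (((ω a).trans γ).trans (ω b).symm)) m -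
          single (R := R) (ofPath ((ω a).trans γ)) m - single (R := R) (ofPath (ω b).symm) m) +
        single (R := R) (ofPath (((ω a).trans γ).trans (ω b).symm)) m -
        (single (R := R) (ofPath ((ω a).trans γ)) m - single (R := R) (ofPath (ω a)) m -
          single (R := R) (ofPath γ) m) +
        (single (R := R) (ofPath ((ω b).trans (ω b).symm)) m - single (R := R) (ofPath (ω b)) m -
          single (R := R) (ofPath (ω b).symm) m) -
        single (R := R) (ofPath ((ω b).trans (ω b).symm)) m := by
    abel
  rw [key]
  exact B.sub_mem (B.add_mem (B.sub_mem (B.add_mem (B.neg_mem h2) h3) h1) h4) h5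

end Boundaries

/-! ### `H₁ = 0` -/

section Vanishing

variable [SimplyConnectedSpace X]

/-- **`H₁(X; M) = 0` for a simply connected space `X`** (Hatcher 2002, §2.A, Thm. 2A.1 in the case
`π₁(X) = 1`: `h : π₁(X) → H₁(X)` is onto with kernel the commutator subgroup, so `H₁(X; ℤ) = 0`;
the same chain-level argument works for every coefficient module `M`). Proof: choose paths `ω_p`
from a base point; the linear map `Φ : C₀ → C₁`, `[p] ↦ ω_p`, satisfies `σ ≡ Φ(∂σ) (mod ∂C₂)` for
every singular `1`-simplex `σ` (`single_ofPath_sub_mem`), hence `z ≡ Φ(∂z) = 0` for every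
`1`-cycle `z`. [cite: HatcherAT2002, Thm. 2A.1] -/
theorem isZero_singularHomology_one_of_simplyConnectedSpace :
    IsZero (singularHomology R M X 1) := by
  obtain ⟨x₀⟩ := (inferInstance : Nonempty X)
  let ω : ∀ p : X, Path x₀ p := fun p => PathConnectedSpace.somePath x₀ p
  set K := singularChainComplex R M X with hK
  set B := boundariesOne R M X with hB
  -- `Φ : C₀ → C₁`, `m [p] ↦ m ω_p`, through the comparison with concrete chains in degree `0`
  let Φ₀ : CChain M X 0 →ₗ[R] K.X 1 :=
    Finsupp.lsum R fun ρ : SingularSimplex X 0 => (singleₗ (R := R) (ofPath (ω ρ.pt)) : M →ₗ[R] K.X 1)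
  let Φ : K.X 0 →ₗ[R] K.X 1 := Φ₀ ∘ₗ (csingularChainComplex.compInv R M X 0).hom
  have hΦ : ∀ (p : X) (m : M), Φ (single (R := R) (ofPoint p) m) = single (R := R) (ofPath (ω p)) m := by
    intro p m
    change Φ₀ ((csingularChainComplex.compInv R M X 0).hom (single (R := R) (ofPoint p) m)) = _
    rw [csingularChainComplex.compInv_single]
    change Finsupp.lsum R _ (Finsupp.single (ofPoint p) m) = _
    rw [Finsupp.lsum_single]
    change single (R := R) (ofPath (ω (ofPoint p).pt)) m = _
    rw [SingularSimplex.pt_ofPoint]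
  -- the two maps `C₁ → C₁/B`: the projection, and `Φ ∘ ∂` followed by the projection, agree
  have hagree : ModuleCat.ofHom B.mkQ =
      K.d 1 0 ≫ ModuleCat.ofHom (B.mkQ ∘ₗ Φ) := by
    refine singularChainComplex.hom_ext fun σ m => ?_
    obtain ⟨a, b, γ, rfl⟩ := σ.exists_eq_ofPath
    change B.mkQ (single (R := R) (ofPath γ) m) = B.mkQ (Φ (K.d 1 0 (single (R := R) (ofPath γ) m)))
    rw [d_single_ofPath, map_sub, hΦ, hΦ, ← sub_eq_zero, ← map_sub, Submodule.mkQ_apply,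
      Submodule.Quotient.mk_eq_zero]
    exact single_ofPath_sub_mem m ω γ
  -- every `1`-cycle is a boundary
  rw [isZero_homology_iff]
  intro z hz
  rw [d_next_eq_zero_iff (ChainComplex.next_nat_succ 0)] at hz
  rw [exists_d_prev_eq_iff (ChainComplex.prev ℕ 1)]
  have hzB : z ∈ B := by
    have h := congrArg (fun φ : K.X 1 ⟶ ModuleCat.of R (K.X 1 ⧸ B) => φ z) hagree
    change B.mkQ z = B.mkQ (Φ (K.d 1 0 z)) at h
    rw [hz, map_zero, map_zero, Submodule.mkQ_apply, Submodule.Quotient.mk_eq_zero] at h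
    exact h
  obtain ⟨w, hw⟩ := hzB
  exact ⟨w, hw⟩

end Vanishing

end Literature.AlgebraicTopology.SingularHomology

end
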